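import Summits.QuantumFields.YangMills.Theorems.BalabanLadderROTGrowthOnClass
import HarnessLib

/-!
# Crux `ROT` (stmt-QuantumFields-20042): the bridge re-run on a torus class — `BridgeOnClass` PROVED

Helper file (`--supports stmt-QuantumFields-20042 --as helper`) of the fleet lead `ym-spine-20042-p1` (generation g2); part 2/2 of the
OWNER-AUTHORISED bridge re-run (ym-beyond-p2 g20, ruling 2026-08-26T17:18:42Z, typed target `BridgeOnClass` of
`pub/ym-beyond/p2-g20-files/R85_closes_preview.lean` a4c2b2513e9cd370, re-homed verbatim in `Theorems/BalabanLadderROTClassDefs.lean`).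
The Y2 bridge from the lattice legs to the Clay data, re-run with the rotation leg holding only on an UNBOUNDED TORUS CLASS `S` and the
bridge CHOOSING its tori inside `S` (part 1/2, `softLegs_joint_growth_on`).  With it the owner's `ROT` rev 2′
(`… → LowerBounds → MomentBounds6 → GapInUnits → ∃ S, UnboundedClass S ∧ LatticeRotWardOn G r a S`) closes the route (`closes_R85'` of the
preview), so the E1 prover works on King-fitted tori only (`q ∣ 2L+1`, `Theorems/BalabanLadderROTCommensurability.lean`) — the
finite-size-insensitivity half of the infrared input located in `FINDING-20042-IR-guard.md` is no longer owed by the rotation leg.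

* `osDataWithGap_of_legs_germ_on` — `Y2Bridge.osDataWithGap_of_legs_germ` re-run on the class (the germ mechanism may use
  `∀ k, sch.L k ∈ S`); `osDataWithGap_of_legs_on` — fed by `LatticeRotWardOn G r a S` through the tree's `germRotAt_of_latticeWardAt`;
  **`bridgeOnClass : BridgeOnClass`**; `yangMills_of_legs_on` — the Clay decl from the legs with the rotation leg in rev-2′ shape.

No definition, no named fact, no sorry; standard axioms.  Bookkeeping of a conditional chain (0 legs discharged); NOT a proof of E1, of the
mass gap or of the Clay statement.
-/

set_option autoImplicit false

noncomputable section

open scoped SchwartzMap ComplexConjugate BigOperators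
open MeasureTheory Filter Topology
open Literature.MathematicalPhysics.QuantumFieldTheory Literature.MathematicalPhysics.QuantumLattice
open Literature.MathematicalPhysics.AQFT Literature.Probability.LatticeModels
open Summit.QuantumFields.YangMills.Cruxes.OSLegsFromFemtoAndGap.DlrCollarTransfer
open Summit.QuantumFields.YangMills.Cruxes.OSLegsAtWeakCouplingC.Sketch
open Summit.QuantumFields.YangMills.Cruxes.OSLegsAtWeakCouplingC.Y2Bridge
open Summit.QuantumFields.YangMills.Theorems.OSLegsFromFemtoAndGap (isHermitian_of_isReflectionPositive latticeDist)
open Summit.QuantumFields.YangMills.Theorems.HypercubicLimit.Negative (onlySpecies latticeSchwinger_onlySpecies_self)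
open Summit.QuantumFields.YangMills.Theorems.NPointIsotropy.Negative (E4)

namespace Summit.QuantumFields.YangMills.Theorems.ROT

variable {G : Type} [Group G] [TopologicalSpace G] [IsTopologicalGroup G] [CompactSpace G]
  [MeasurableSpace G] [BorelSpace G]

/-- **OS data with BOTH gaps from UV, NT, IR and ANY germ mechanism, along a scheme with tori IN THE CLASS `S`** — the tree's
`Y2Bridge.osDataWithGap_of_legs_germ` re-run with the soft bundle of `softLegs_joint_growth_on`; the abstract germ input `hGERM` may
use `∀ k, sch.L k ∈ S`. [folklore; glue] -/
theorem osDataWithGap_of_legs_germ_on (r : LatticeRep G) (a : ℝ → ℝ) (hapos : ∀ β, 0 < a β)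
    (ha0 : Tendsto a atTop (𝓝 0)) (hUV : MomentBounds6 G r a) (hNT : LowerBounds G r a) (hIR : GapInUnits G r a)
    (S : Set ℕ) (hS : UnboundedClass S)
    (hGERM : ∀ (sch : SpeciesScheme (YMSpecies G)) (S₁ : SchwingerFamily E4)
      (Tq : (n : ℕ) → (Fin n → Fin 4 × Fin 4) → (𝓢((Fin n → E4), ℂ) →L[ℂ] ℂ)) (K b₀ : ℝ) (g : ℝ → ℕ → ℕ),
      SoftBundle G r a sch S₁ Tq K b₀ g → (∀ k, sch.L k ∈ S) → OffDiagDensity S₁ →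
        ∃ r₁ : ℝ, 0 < r₁ ∧ ∀ R : E4 ≃ₗᵢ[ℝ] E4, LinearMap.det (R.toLinearEquiv : E4 →ₗ[ℝ] E4) = 1 →
          IsPlanar01 R → GermInvariant S₁ R r₁) :
    ∃ (sch : SpeciesScheme (YMSpecies G)) (T : OSData (YMSpecies G) 4),
      (∀ k, sch.L k ∈ S) ∧ (∀ k, sch.a k = a (sch.β k)) ∧ sch.HasWeakCouplingLimit ∧ IsYangMillsFor r sch T ∧
        T.IsNontrivial r.curvature ∧ T.IsNonGaussian r.curvature ∧
        ∃ Δ > 0, T.HasMassGap Δ ∧ HasLatticeMassGap r sch Δ := by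
  -- adapted verbatim from `Y2Bridge.osDataWithGap_of_legs_germ` (Theorems/Y2BridgeClay.lean): the soft bundle now comes from
  -- `softLegs_joint_growth_on` (tori in `S`), and the germ mechanism may use `∀ k, sch.L k ∈ S`.
  -- the rope's demands, then the soft bundle meeting them ON THE CLASS (compactness + inheritance)
  obtain ⟨b₀, g, Δ, hΔ, hRD⟩ := stub_rope G r a hapos ha0 hIR
  obtain ⟨sch, S₁, Tq, K, hB, hLS⟩ :=
    Summit.QuantumFields.YangMills.Theorems.OSLegsFromFemtoAndGap.softLegs_joint_growth_on r hapos ha0 hUV hNT hIR b₀ g S hS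
  obtain ⟨hRP, hDec⟩ := hRD sch S₁ Tq K hB
  have hsigned : ∀ R : E4 ≃ₗᵢ[ℝ] E4, IsSignedPerm R → Invariant S₁ R :=
    fun R hR n F hF => stub_hypercubic G r a sch S₁ Tq K b₀ g hB n R hR F hF
  have hdens : OffDiagDensity S₁ := stub_density G r a sch S₁ Tq K b₀ g hUV hB
  -- unpack the bundle
  obtain ⟨⟨hunits, -, -, hβ, hN, hLG, hE3, htrans, h0, h1', -, -, hYM, hnt, hng, ⟨Δ', hΔ', hlat⟩, hranges, -⟩, -⟩ :=
    id hB
  -- E1: det-1 planar germ invariance (from the abstract mechanism) ⇒ planar invariance ⇒ SO(4)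
  obtain ⟨r₁, hr₁, hgermR⟩ := hGERM sch S₁ Tq K b₀ g hB hLS hdens
  -- continuum side
  obtain ⟨hCS, hgapOf⟩ := stub_gap S₁ h0 htrans hRP
  have hE4 : S₁.toLabelled.HasClusterProperty :=
    stub_cluster S₁ Δ hΔ h0 h1' htrans (fun n R hR F hF => hsigned R hR n F hF) hCS hDec
  have hplanar : ∀ R : E4 ≃ₗᵢ[ℝ] E4, LinearMap.det (R.toLinearEquiv : E4 →ₗ[ℝ] E4) = 1 → IsPlanar01 R →
      Invariant S₁ R := fun R hdet hR =>
    stub_locality S₁ h0 htrans hE3 hLG hRP hsigned hdens R hR r₁ hr₁ (hgermR R hdet hR)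
  have hE1 : S₁.toLabelled.IsEuclideanInvariant := isEuclideanInvariant_of_planarRot S₁ htrans hsigned hplanar
  have hE2 : S₁.toLabelled.IsReflectionPositive := isReflectionPositive_of_rpPos hRP
  have hherm : S₁.toLabelled.IsHermitian := isHermitian_of_isReflectionPositive S₁ hN hE2
  have hOS : OSAxiomsSchwinger S₁.toLabelled :=
    { normalized := hN, hermitian := hherm, invariant := hE1, reflectionPositive := hE2, symmetric := hE3,
      cluster := hE4, linearGrowth := hLG }
  -- the continuum gap the tree derives and drops, and the common rate
  have hgap : S₁.toLabelled.HasMassGap Δ := hgapOf Δ hΔ hDec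
  have hΔ₀ : 0 < min Δ Δ' := lt_min hΔ hΔ'
  have hgap₀ : S₁.toLabelled.HasMassGap (min Δ Δ') := hasMassGap_anti hgap (min_le_left _ _)
  have hlat₀ : HasLatticeMassGap r sch (min Δ Δ') := hasLatticeMassGap_anti r sch hlat (min_le_right _ _)
  -- one OS field (species `Unit`), then extension by zero along the silenced scheme
  have hc : ∀ s : YMSpecies G, s ≠ r.curvature → ∀ k, (onlySpecies sch r.curvature).c s k = 0 := by
    intro s hs k
    simp [onlySpecies, hs]
  have hconv : ∀ n : ℕ, n ≠ 0 → ∀ (f : Fin n → 𝓢(E4, ℝ)) (F : 𝓢((Fin n → E4), ℂ)),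
      IsTensorOf F (fun i => ofRealTest (f i)) → IsOffDiagonal F →
        Tendsto (fun k : ℕ => ((latticeSchwinger r.ρ (onlySpecies sch r.curvature) (fun s => s.F) k n
          (fun _ => r.curvature) f : ℝ) : ℂ)) atTop
          (𝓝 ((OSData.ofAxioms S₁.toLabelled hOS).schwinger n (fun _ => ()) F)) := by
    intro n hn f F hF hod
    simp_rw [latticeSchwinger_onlySpecies_self]
    rw [OSData.ofAxioms_schwinger, SchwingerFamily.toLabelled_apply]
    exact hYM n hn f F hF hod
  have hNT' : (OSData.ofAxioms S₁.toLabelled hOS).IsNontrivial () := by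
    unfold OSData.IsNontrivial
    simpa only [OSData.ofAxioms_schwinger] using hnt
  have hNG' : (OSData.ofAxioms S₁.toLabelled hOS).IsNonGaussian () := by
    unfold OSData.IsNonGaussian
    simpa only [OSData.ofAxioms_schwinger] using hng
  have hgapT : (OSData.ofAxioms S₁.toLabelled hOS).HasMassGap (min Δ Δ') := by
    unfold OSData.HasMassGap
    simpa only [OSData.ofAxioms_schwinger] using hgap₀
  obtain ⟨T, hYM', hntT, hngT, Δ₁, hΔ₁, hgapT', hlatT⟩ :=
    exists_yangMillsWitness_of_oneSpecies r (onlySpecies sch r.curvature) hc (OSData.ofAxioms S₁.toLabelled hOS)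
      hconv hNT' hNG' hΔ₀ hgapT hlat₀
  exact ⟨onlySpecies sch r.curvature, T, hLS, hunits, hβ, hYM', hntT, hngT, Δ₁, hΔ₁, hgapT', hlatT⟩

/-- **OS data with BOTH gaps from `MomentBounds6 ∧ LowerBounds ∧ GapInUnits` and the rotation leg ON AN UNBOUNDED CLASS** (tree
`germRotAt_of_latticeWardAt` fed by `LatticeRotWardOn G r a S` along the class-`S` scheme). [folklore; glue] -/
theorem osDataWithGap_of_legs_on (r : LatticeRep G) (a : ℝ → ℝ) (hapos : ∀ β, 0 < a β)
    (ha0 : Tendsto a atTop (𝓝 0)) (hUV : MomentBounds6 G r a) (hNT : LowerBounds G r a) (hIR : GapInUnits G r a)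
    (S : Set ℕ) (hS : UnboundedClass S) (hROT : LatticeRotWardOn G r a S) :
    ∃ (sch : SpeciesScheme (YMSpecies G)) (T : OSData (YMSpecies G) 4),
      (∀ k, sch.L k ∈ S) ∧ (∀ k, sch.a k = a (sch.β k)) ∧ sch.HasWeakCouplingLimit ∧ IsYangMillsFor r sch T ∧
        T.IsNontrivial r.curvature ∧ T.IsNonGaussian r.curvature ∧
        ∃ Δ > 0, T.HasMassGap Δ ∧ HasLatticeMassGap r sch Δ := by
  refine osDataWithGap_of_legs_germ_on r a hapos ha0 hUV hNT hIR S hS fun sch S₁ Tq K b₀ g hB hLS hdens => ?_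
  obtain ⟨⟨hunits, -, -, hβ, -, -, -, -, -, -, -, -, -, -, -, -, hranges, -⟩, -⟩ := id hB
  obtain ⟨r₀, hr₀, hW⟩ := hROT sch hLS hunits hβ hranges
  exact germRotAt_of_latticeWardAt r a sch S₁ Tq K b₀ g hB hdens hr₀ hW

/-- **`BridgeOnClass` PROVED** — the owner's typed target (ruling 2026-08-26T17:18:42Z; `Theorems/BalabanLadderROTClassDefs.lean`):
the bridge from the three lattice legs and the rotation leg on any unbounded torus class to the Yang–Mills OS data with both gaps.
[folklore; glue] -/
theorem bridgeOnClass : BridgeOnClass := by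
  intro G _ _ _ _ hG
  letI : MeasurableSpace G := borel G
  haveI : BorelSpace G := ⟨rfl⟩
  intro r a hapos ha0 hUV hNT hIR S hS hROT
  obtain ⟨sch, T, -, -, hβ, hYM, hnt, hng, Δ, hΔ, hgap, hlat⟩ :=
    osDataWithGap_of_legs_on r a hapos ha0 hUV hNT hIR S hS hROT
  exact ⟨sch, T, hβ, hYM, hnt, hng, Δ, hΔ, hgap, hlat⟩

/-- **`YangMills ⇐ UV ∧ NT ∧ IR ∧ (ROT on some unbounded class)`** — for every compact simple `G` SOME `r`, SOME positive unit map
`a → 0` and SOME unbounded torus class carrying the legs; conclusion the tree's `_root_.YangMills` (the rev-2′ shape of the rotation leg,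
cf. the owner's `closes_R85'`). [folklore; glue] -/
theorem yangMills_of_legs_on
    (h : ∀ (G : Type) [Group G] [TopologicalSpace G] [IsTopologicalGroup G] [CompactSpace G],
      IsCompactSimpleLieGroup G → letI : MeasurableSpace G := borel G; haveI : BorelSpace G := ⟨rfl⟩;
      ∃ (r : LatticeRep G) (a : ℝ → ℝ), (∀ β, 0 < a β) ∧ Tendsto a atTop (𝓝 0) ∧
        MomentBounds6 G r a ∧ LowerBounds G r a ∧ GapInUnits G r a ∧
        ∃ S : Set ℕ, UnboundedClass S ∧ LatticeRotWardOn G r a S) :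
    YangMills := by
  intro G _ _ _ _ hG
  letI : MeasurableSpace G := borel G
  haveI : BorelSpace G := ⟨rfl⟩
  obtain ⟨r, a, hapos, ha0, hUV, hNT, hIR, S, hS, hROT⟩ := h G hG
  obtain ⟨sch, T, -, -, hβ, hYM, hnt, hng, Δ, hΔ, hgap, hlat⟩ :=
    osDataWithGap_of_legs_on r a hapos ha0 hUV hNT hIR S hS hROT
  exact ⟨r, sch, T, hβ, hYM, hnt, hng, Δ, hΔ, hgap, hlat⟩

end Summit.QuantumFields.YangMills.Theorems.ROT

end
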